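import Literature.MathematicalPhysics.QuantumManyBody.BoseGasFreeDirichletBEC
import Literature.MathematicalPhysics.QuantumManyBody.DyadicCoherentFraction
import HarnessLib

/-!
# Route `BECTangentRigidity`, crux `MesoscopicFloor` (stmt-AtomisticToContinuum-13035),
# line registered (`Lines/birth.lean`): the registered stub `stub_cellPoincare`

Supports (does not close) stmt-AtomisticToContinuum-13035; stub `stub_cellPoincare` of the birth
line "kinetic gap at the dyadic-cell scale".

**Dyadic-cell Poincaré for bosonic Dirichlet trial states.** There is a universal constant
`C > 0` (namely `C = π⁻²`, the inverse Neumann gap of the unit cube) such that for every box side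
`L > 0`, every dyadic level `k` (cells of side `s = L/2^k` partitioning `[0,L)³ ⊇ Λ_L`) and every
bosonic Dirichlet trial state `Ψ` of `N` particles in `Λ_L`,

`N ≤ Σ_Q ⟨φ_Q, γ_Ψ φ_Q⟩ + C s² ∫ |∇Ψ|²`,

every particle being either in the flat mode of its own cell or kinetically excited at the cell's
Neumann gap `π²/s²`.  This is LITERALLY the tree's `BoseGas.key_inequality`
(`BoseGasFreeDirichletBEC.lean`: `(π/ℓ)² N ≤ energy 0 Ψ + (π/ℓ)² Σ_q ⟨u_q, γ_Ψ u_q⟩` for `L = kℓ`)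
at `2^k` sub-cells per axis, `ℓ = L/2^k`, after the identifications

* `dyCell L k q = subCell (L/2^k) q` and `dyMode L k q = subMode (L/2^k) q` (same index type
  `Fin 3 → Fin (2^k)`, same half-open cells, same normalisation `(√(ℓ³))⁻¹`), whence
  `cohSum N L k Ψ = Σ_q ⟨subMode, γ_Ψ subMode⟩`;
* `energy 0 Ψ = ∫ kineticDensity Ψ.ψ` (no interaction);

and division by `ofReal (π/ℓ)²` in `ℝ≥0∞` (`(ofReal (π/ℓ)²)⁻¹ = ofReal (π⁻² ℓ²)`).  `N = 0` is
trivial (`ofReal 0 = 0`).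

## References

* [LSSY2005] E. H. Lieb, R. Seiringer, J. P. Solovej, J. Yngvason, *The Mathematics of the Bose Gas
  and its Condensation* (2005), Ch. 5 (5.15)–(5.17) (Poincaré / gap method), §1.2 (1.17).
-/

noncomputable section

open MeasureTheory
open scoped ENNReal NNReal

namespace Summit.AtomisticToContinuum.BoseEinsteinCondensation.Theorems.MesoscopicFloor

open Literature.MathematicalPhysics.QuantumManyBody.BoseGas

namespace CellPoincare

/-- The dyadic cell of level `k` and index `q` is the sub-cell `q` of side `L/2^k` of
`BoseGasFreeDirichletBEC` (both are `∏_j [q_j s, q_j s + s)`, `s = L/2^k`). [folklore] -/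
theorem dyCell_eq_subCell (L : ℝ) (k : ℕ) (q : Fin 3 → Fin (2 ^ k)) :
    dyCell L k q = subCell (L / 2 ^ k) q := by
  ext x
  simp only [mem_dyCell_iff, mem_subCell]
  refine forall_congr' fun j => ?_
  rw [mul_comm (L / 2 ^ k), add_mul, one_mul]

/-- The dyadic flat mode of level `k` and index `q` is the sub-cell constant mode `u_q` of side
`L/2^k` of `BoseGasFreeDirichletBEC`. [folklore] -/
theorem dyMode_eq_subMode (L : ℝ) (k : ℕ) (q : Fin 3 → Fin (2 ^ k)) :
    dyMode L k q = subMode (L / 2 ^ k) q := by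
  rw [subMode_eq_indicator, ← dyCell_eq_subCell]
  rfl

/-- The dyadic coherent sum at level `k` is the sum of the occupations of the `(2^k)³` sub-cell
constant modes of side `L/2^k`. [folklore] -/
theorem cohSum_eq_sum_occupation_subMode (N : ℕ) (L : ℝ) (k : ℕ) (Ψ : Config N → ℂ) :
    cohSum N L k Ψ = ∑ q : SubIdx (2 ^ k), occupation N (subMode (L / 2 ^ k) q) Ψ := by
  simp only [cohSum, dyMode_eq_subMode]

/-- Without interaction the energy of a trial state is its kinetic energy:
`energy 0 Ψ = ∫ |∇Ψ|²`. [folklore] -/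
theorem energy_zero_eq_lintegral_kineticDensity {N : ℕ} {L : ℝ} (Ψ : TrialState N L) :
    energy 0 Ψ = ∫⁻ X, kineticDensity Ψ.ψ X := by
  simp [energy, interaction]

/-- The inverse of the cell gap factor: `(ofReal (π/ℓ)²)⁻¹ = ofReal (π⁻² ℓ²)` for `ℓ > 0`.
[folklore] -/
theorem inv_ofReal_gap {ℓ : ℝ} (hℓ : 0 < ℓ) :
    (ENNReal.ofReal ((Real.pi / ℓ) ^ 2))⁻¹ = ENNReal.ofReal ((Real.pi ^ 2)⁻¹ * ℓ ^ 2) := by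
  rw [← ENNReal.ofReal_inv_of_pos (by positivity)]
  congr 1
  rw [div_pow, inv_div]
  ring

end CellPoincare

open CellPoincare in
/-- **Stub `stub_cellPoincare` of the birth line — dyadic-cell Poincaré for bosonic trial
states.** There is a universal `C > 0` (here `C = π⁻²`) such that for every `L > 0`, every dyadic
level `k` and every bosonic Dirichlet trial state `Ψ` of `N` particles in `Λ_L`,
`ofReal N ≤ cohSum N L k Ψ.ψ + ofReal (C (L/2^k)²) ∫ kineticDensity Ψ.ψ`.  Proof: the tree's
`key_inequality` at `2^k` sub-cells per axis, `ℓ = L/2^k`, transported along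
`dyMode L k q = subMode ℓ q` and `energy 0 Ψ = ∫ kineticDensity`, then multiplied by
`(ofReal (π/ℓ)²)⁻¹ = ofReal (π⁻² ℓ²)`; `N = 0` is trivial.
[cite: LSSY2005, Ch. 5 (5.15)–(5.17)] -/
theorem stub_cellPoincare :
    ∃ C : ℝ, 0 < C ∧ ∀ (N : ℕ) (L : ℝ), 0 < L → ∀ (k : ℕ) (Ψ : TrialState N L),
      ENNReal.ofReal (N : ℝ) ≤ cohSum N L k Ψ.ψ +
        ENNReal.ofReal (C * (L / 2 ^ k) ^ 2) * ∫⁻ X, kineticDensity Ψ.ψ X := by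
  refine ⟨(Real.pi ^ 2)⁻¹, by positivity, fun N L hL k Ψ => ?_⟩
  cases N with
  | zero => simp
  | succ n =>
    have hℓ : 0 < L / 2 ^ k := by positivity
    have hkℓ : ((2 ^ k : ℕ) : ℝ) * (L / 2 ^ k) = L := by
      push_cast
      field_simp
    have hkey := key_inequality hℓ hkℓ Ψ
    set a : ℝ≥0∞ := ENNReal.ofReal ((Real.pi / (L / 2 ^ k)) ^ 2) with ha
    set S : ℝ≥0∞ := ∑ q : SubIdx (2 ^ k), occupation (n + 1) (subMode (L / 2 ^ k) q) Ψ.ψ with hS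
    have ha0 : a ≠ 0 := (ENNReal.ofReal_pos.2 (by positivity)).ne'
    have hat : a ≠ ⊤ := ENNReal.ofReal_ne_top
    rw [ENNReal.ofReal_natCast, Nat.cast_succ, cohSum_eq_sum_occupation_subMode, ← hS,
      ← inv_ofReal_gap hℓ, ← ha, ← energy_zero_eq_lintegral_kineticDensity Ψ]
    calc (n + 1 : ℝ≥0∞) = a⁻¹ * (a * (n + 1 : ℝ≥0∞)) := by
          rw [← mul_assoc, ENNReal.inv_mul_cancel ha0 hat, one_mul]
      _ ≤ a⁻¹ * (energy 0 Ψ + a * S) := by gcongr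
      _ = S + a⁻¹ * energy 0 Ψ := by
          rw [mul_add, ← mul_assoc, ENNReal.inv_mul_cancel ha0 hat, one_mul, add_comm]

end Summit.AtomisticToContinuum.BoseEinsteinCondensation.Theorems.MesoscopicFloor

end
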